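import Mathlib.Analysis.Normed.Module.Basic
import Mathlib.Algebra.Module.Submodule.Basic
import Mathlib.Tactic.Module
import HarnessLib

/-!
# `AlphaInputsT3ACv3TransfiniteFill` — row (S4) of the 19936 (FL) START v3 (★★OWNER g25 RULING 2026-08-28T02:16:33Z; LEAD memo `NONABELIAN-FL-START-w1-g2.md` §3 (B), §4 (S4)):
# the TRANSFINITE (COONS) FILL of a boundary lattice 1-form into the lattice cube `{0,…,N}³` — μ-bonds blended BILINEARLY from the four faces parallel to μ — EXACT on every boundary
# bond, `‖fill‖ ≤ 3·a`, and ★★ `‖curl fill‖ ≤ b + 8a∕N` at every plaquette of the cube from `‖curl A_∂‖ ≤ b` on the faces and `‖A_∂‖ ≤ a` on the boundary bonds (the blend uses the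
# SAME weights for both components, so the face CURLS appear, not tangential derivatives) — values in ANY real normed space (ℝ, `M_n(ℂ)`, `𝔰𝔲(n)`), so no separate matrix port —
# cell `ym3-torus`, width seat `ym-ust-19936-w3` (g0)

WHY (memo v3 §3 (B)): the START `U⁰` of the `hLift` contraction modifies the section `iterSec k V` in cubes `Q` (half-side `R`, `N = 2R`) around interior vertices: in the comb-axial gauge
of `∂Q` the boundary logarithms `A_∂` are uniformly small (`‖A_∂‖ ≤ a = 6R·b`, `‖curl A_∂‖ ≤ b` on the faces), and `A :=` the transfinite interpolation of `A_∂` into `Q` must be EXACT on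
`∂Q` (so `e^{A}` glues to the outside field without a seam), with `‖dA‖ ≤ C(b + a∕R)` and `‖A‖ ≤ 3a` — then `U := (e^{A})^{σ̃⁻¹}` has plaquettes `≤ C(b + a∕R) + O(a²)` inside `Q`.  THIS FILE is
the interpolation letter on the MODEL cube `{0,…,N}³ ⊂ ℤ³` (points `Fin 3 → ℤ`; the translate∕embedding into `Site (F.P K) 0` is the assembler's, (S5)):
* §1 carriers: `setc` (set a coordinate), `bump` (unit step), the transverse directions `tA μ`, `tB μ`, the weights `w0 N s = (N − s)∕N`, `w1 N s = s∕N`; `InBox`, `BdryBond`.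
* §2 `coons N A x μ ν λ` (the bilinear Coons blend of the μ-component from the faces normal to `ν` and to `λ`), `coons_swap`, `fill N A x μ := coons N A x μ (tA μ) (tB μ)`,
  `fill_eq_coons` (any ordering of the two transverse directions).
* §3 ★ `fill_eq_of_bdry` (EXACT on every boundary bond), `fill_mem` (values in any `ℝ`-submodule containing the data — `𝔰𝔲`-valuedness), ★ `norm_fill_le` (`≤ 3·a` in the box).
* §4 `dcurl` (the lattice curl on `ℤ³`), ★★ `dcurl_fill_eq` (`dcurl (fill N A) x μ ν = w0(x_λ)•dcurl A (x|λ↦0) μ ν + w1(x_λ)•dcurl A (x|λ↦N) μ ν + rem`, `rem` = `(1∕N)`× eight boundary values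
  with weights of modulus `≤ 1`, EXPLICIT), ★★ `norm_dcurl_fill_le` (`≤ b + 8·a∕N`).
HONEST FRAMING.  Lattice bookkeeping on a model cube; nothing of [Balaban1985UV3]∕[Balaban1985Variational]∕[Balaban1985Averaging] is asserted; the START, (FL)∕`hLift`, the stub 2′χ,
the crux `HistoryTailL` and any gap are NOT claimed; count-neutral helper (`--supports stmt-QuantumFields-19936`); registry untouched.  YM₃ on the three-torus is a RUNG of the
programme, not the Clay problem; nothing here is about d = 4, infinite volume or a mass gap.

References: S. A. Coons, «Surfaces for computer-aided design of space forms», MIT MAC-TR-41 (1967) [folklore: the bilinearly blended Coons patch]; T. Bałaban, Commun. Math. Phys. 102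
(1985) 277–309 [Balaban1985Variational] ((8), (11)–(13) pp.279–280: the regular extension the START realises).
-/

set_option autoImplicit false

noncomputable section

namespace Summit.QuantumFields.YangMills.Theorems

namespace TransfiniteFill

/-! ## §1 Carriers on the model cube `{0,…,N}³ ⊂ ℤ³` -/

/-- Set the `i`-th coordinate of a point of `ℤ³` to `v`. [folklore] -/
def setc (x : Fin 3 → ℤ) (i : Fin 3) (v : ℤ) : Fin 3 → ℤ := Function.update x i v

/-- The unit step `x + e_i`. [folklore] -/
def bump (x : Fin 3 → ℤ) (i : Fin 3) : Fin 3 → ℤ := Function.update x i (x i + 1)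

/-- The set coordinate reads the new value. [folklore] -/
@[simp] theorem setc_apply_same (x : Fin 3 → ℤ) (i : Fin 3) (v : ℤ) : setc x i v i = v := by simp [setc]
/-- The other coordinates are unchanged by `setc`. [folklore] -/
@[simp] theorem setc_apply_ne (x : Fin 3 → ℤ) {i j : Fin 3} (h : j ≠ i) (v : ℤ) : setc x i v j = x j := by simp [setc, h]
/-- The bumped coordinate reads `x i + 1`. [folklore] -/
@[simp] theorem bump_apply_same (x : Fin 3 → ℤ) (i : Fin 3) : bump x i i = x i + 1 := by simp [bump]
/-- The other coordinates are unchanged by `bump`. [folklore] -/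
@[simp] theorem bump_apply_ne (x : Fin 3 → ℤ) {i j : Fin 3} (h : j ≠ i) : bump x i j = x j := by simp [bump, h]

/-- Setting the bumped coordinate forgets the bump. [folklore] -/
@[simp] theorem setc_bump_same (x : Fin 3 → ℤ) (i : Fin 3) (v : ℤ) : setc (bump x i) i v = setc x i v := by
  simp [setc, bump]

/-- Setting another coordinate commutes with the bump. [folklore] -/
theorem setc_bump_ne (x : Fin 3 → ℤ) {i j : Fin 3} (h : j ≠ i) (v : ℤ) : setc (bump x i) j v = bump (setc x j v) i := by
  funext l
  by_cases hl : l = i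
  · subst hl; simp [setc, bump, Function.update_of_ne (Ne.symm h)]
  · by_cases hl' : l = j
    · subst hl'; simp [setc, bump, hl]
    · simp [setc, bump, hl, hl']

/-- Setting two different coordinates commutes. [folklore] -/
theorem setc_comm (x : Fin 3 → ℤ) {i j : Fin 3} (h : i ≠ j) (v w : ℤ) : setc (setc x i v) j w = setc (setc x j w) i v := by
  simp only [setc]; exact Function.update_comm h v w x

/-- Setting a coordinate to its own value does nothing. [folklore] -/
@[simp] theorem setc_self (x : Fin 3 → ℤ) (i : Fin 3) : setc x i (x i) = x := by simp [setc]

/-- The first transverse direction of `μ`. [folklore] -/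
def tA (μ : Fin 3) : Fin 3 := if μ = 0 then 1 else 0

/-- The second transverse direction of `μ`. [folklore] -/
def tB (μ : Fin 3) : Fin 3 := if μ = 2 then 1 else 2

/-- The first transverse direction differs from `μ`. [folklore] -/
theorem tA_ne (μ : Fin 3) : tA μ ≠ μ := by unfold tA; fin_cases μ <;> decide
/-- The second transverse direction differs from `μ`. [folklore] -/
theorem tB_ne (μ : Fin 3) : tB μ ≠ μ := by unfold tB; fin_cases μ <;> decide
/-- The two transverse directions are distinct. [folklore] -/
theorem tA_ne_tB (μ : Fin 3) : tA μ ≠ tB μ := by unfold tA tB; fin_cases μ <;> decide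

/-- Every direction other than `μ` is one of its two transverse directions. [folklore] -/
theorem eq_tA_or_tB {μ i : Fin 3} (h : i ≠ μ) : i = tA μ ∨ i = tB μ := by
  unfold tA tB; fin_cases μ <;> fin_cases i <;> simp_all

/-- Two distinct transverse directions are `(tA μ, tB μ)` in some order. [folklore] -/
theorem transverse_cases {μ ν l : Fin 3} (hν : ν ≠ μ) (hl : l ≠ μ) (hνl : ν ≠ l) : (tA μ = ν ∧ tB μ = l) ∨ (tA μ = l ∧ tB μ = ν) := by
  unfold tA tB; fin_cases μ <;> fin_cases ν <;> fin_cases l <;> simp_all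

/-- The weight of the face `{x_i = 0}`: `(N − s)∕N`. [folklore] -/
def w0 (N : ℕ) (s : ℤ) : ℝ := ((N : ℝ) - (s : ℝ)) / (N : ℝ)

/-- The weight of the face `{x_i = N}`: `s∕N`. [folklore] -/
def w1 (N : ℕ) (s : ℤ) : ℝ := (s : ℝ) / (N : ℝ)

/-- `w0 N 0 = 1`. [folklore] -/
theorem w0_zero {N : ℕ} (hN : N ≠ 0) : w0 N 0 = 1 := by have : (N : ℝ) ≠ 0 := (by exact_mod_cast hN); simp [w0, this]
/-- `w1 N 0 = 0`. [folklore] -/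
theorem w1_zero (N : ℕ) : w1 N 0 = 0 := by simp [w1]
/-- `w0 N N = 0`. [folklore] -/
theorem w0_top (N : ℕ) : w0 N N = 0 := by simp [w0]
/-- `w1 N N = 1`. [folklore] -/
theorem w1_top {N : ℕ} (hN : N ≠ 0) : w1 N N = 1 := by have : (N : ℝ) ≠ 0 := (by exact_mod_cast hN); simp [w1, this]
/-- The two weights of a pair of opposite faces sum to `1`. [folklore] -/
theorem w0_add_w1 {N : ℕ} (hN : N ≠ 0) (s : ℤ) : w0 N s + w1 N s = 1 := by
  have : (N : ℝ) ≠ 0 := by exact_mod_cast hN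
  unfold w0 w1; field_simp; ring
/-- One lattice step lowers `w0` by `1∕N`. [folklore] -/
theorem w0_succ {N : ℕ} (hN : N ≠ 0) (s : ℤ) : w0 N (s + 1) = w0 N s - (N : ℝ)⁻¹ := by
  have : (N : ℝ) ≠ 0 := by exact_mod_cast hN
  unfold w0; push_cast; field_simp; ring
/-- One lattice step raises `w1` by `1∕N`. [folklore] -/
theorem w1_succ {N : ℕ} (hN : N ≠ 0) (s : ℤ) : w1 N (s + 1) = w1 N s + (N : ℝ)⁻¹ := by
  have : (N : ℝ) ≠ 0 := by exact_mod_cast hN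
  unfold w1; push_cast; field_simp
/-- `0 ≤ w0` below the top face. [folklore] -/
theorem w0_nonneg {N : ℕ} {s : ℤ} (hs : s ≤ N) : 0 ≤ w0 N s := by
  unfold w0; apply div_nonneg _ (Nat.cast_nonneg _); have : (s : ℝ) ≤ N := (by exact_mod_cast hs); linarith
/-- `0 ≤ w1` above the bottom face. [folklore] -/
theorem w1_nonneg (N : ℕ) {s : ℤ} (hs : 0 ≤ s) : 0 ≤ w1 N s := by
  unfold w1; exact div_nonneg (by exact_mod_cast hs) (Nat.cast_nonneg _)
/-- `w0 ≤ 1` above the bottom face. [folklore] -/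
theorem w0_le_one (N : ℕ) {s : ℤ} (hs : 0 ≤ s) : w0 N s ≤ 1 := by
  unfold w0
  rcases Nat.eq_zero_or_pos N with h | h
  · subst h; simp
  · rw [div_le_one (by exact_mod_cast h)]; have : (0 : ℝ) ≤ s := (by exact_mod_cast hs); linarith
/-- `w1 ≤ 1` below the top face. [folklore] -/
theorem w1_le_one (N : ℕ) {s : ℤ} (hs : s ≤ N) : w1 N s ≤ 1 := by
  unfold w1
  rcases Nat.eq_zero_or_pos N with h | h
  · subst h; simp
  · rw [div_le_one (by exact_mod_cast h)]; exact_mod_cast hs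

/-- The point lies in the cube `{0,…,N}³`. [folklore] -/
def InBox (N : ℕ) (x : Fin 3 → ℤ) : Prop := ∀ i, 0 ≤ x i ∧ x i ≤ N

/-- The bond `(x, μ)` lies in a FACE of the cube: some coordinate other than `μ` is `0` or `N`. [folklore] -/
def BdryBond (N : ℕ) (x : Fin 3 → ℤ) (μ : Fin 3) : Prop := ∃ i, i ≠ μ ∧ (x i = 0 ∨ x i = N)

/-- Setting a coordinate to a value in `[0, N]` stays in the box. [folklore] -/
theorem inBox_setc {N : ℕ} {x : Fin 3 → ℤ} (hx : InBox N x) (i : Fin 3) {v : ℤ} (hv0 : 0 ≤ v) (hvN : v ≤ N) : InBox N (setc x i v) := by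
  intro j; by_cases h : j = i
  · subst h; simp [hv0, hvN]
  · simp [setc_apply_ne x h, hx j]

/-- A bond with a transverse coordinate set to `0` is a boundary bond. [folklore] -/
theorem bdry_setc_zero (N : ℕ) (x : Fin 3 → ℤ) {i μ : Fin 3} (h : i ≠ μ) : BdryBond N (setc x i 0) μ := ⟨i, h, Or.inl (by simp)⟩
/-- A bond with a transverse coordinate set to `N` is a boundary bond. [folklore] -/
theorem bdry_setc_top (N : ℕ) (x : Fin 3 → ℤ) {i μ : Fin 3} (h : i ≠ μ) : BdryBond N (setc x i N) μ := ⟨i, h, Or.inr (by simp)⟩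
/-- A bond with a transverse coordinate set to `0` or `N` stays a boundary bond after setting another coordinate. [folklore] -/
theorem bdry_setc_setc_inner (N : ℕ) (x : Fin 3 → ℤ) {i j μ : Fin 3} (h : i ≠ μ) (hij : i ≠ j) {v : ℤ} (hv : v = 0 ∨ v = N) (w : ℤ) :
    BdryBond N (setc (setc x i v) j w) μ :=
  ⟨i, h, by rw [setc_apply_ne _ hij]; simpa using hv⟩

/-! ## §2 The Coons blend -/

variable {V : Type*} [AddCommGroup V] [Module ℝ V]

/-- **THE BILINEAR COONS BLEND** of the `μ`-component from the faces normal to `ν` and to `l` (the two transverse directions): the four face values with weights `w0∕w1`, minus the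
bilinearly weighted four corner-line values. [folklore] -/
def coons (N : ℕ) (A : (Fin 3 → ℤ) → Fin 3 → V) (x : Fin 3 → ℤ) (μ ν l : Fin 3) : V :=
  w0 N (x ν) • A (setc x ν 0) μ + w1 N (x ν) • A (setc x ν N) μ + w0 N (x l) • A (setc x l 0) μ + w1 N (x l) • A (setc x l N) μ
    - (w0 N (x ν) • (w0 N (x l) • A (setc (setc x ν 0) l 0) μ + w1 N (x l) • A (setc (setc x ν 0) l N) μ)
      + w1 N (x ν) • (w0 N (x l) • A (setc (setc x ν N) l 0) μ + w1 N (x l) • A (setc (setc x ν N) l N) μ))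

/-- The blend is symmetric in the two transverse directions. [folklore] -/
theorem coons_swap (N : ℕ) (A : (Fin 3 → ℤ) → Fin 3 → V) (x : Fin 3 → ℤ) (μ : Fin 3) {ν l : Fin 3} (hνl : ν ≠ l) :
    coons N A x μ ν l = coons N A x μ l ν := by
  unfold coons
  rw [setc_comm x hνl 0 0, setc_comm x hνl 0 (N : ℤ), setc_comm x hνl (N : ℤ) 0, setc_comm x hνl (N : ℤ) (N : ℤ)]
  module

/-- **THE TRANSFINITE (COONS) FILL**: the `μ`-component blended from the four faces parallel to `μ`. [folklore] -/
def fill (N : ℕ) (A : (Fin 3 → ℤ) → Fin 3 → V) (x : Fin 3 → ℤ) (μ : Fin 3) : V := coons N A x μ (tA μ) (tB μ)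

/-- The fill written with ANY ordering of the two transverse directions. [folklore] -/
theorem fill_eq_coons (N : ℕ) (A : (Fin 3 → ℤ) → Fin 3 → V) (x : Fin 3 → ℤ) {μ ν l : Fin 3} (hν : ν ≠ μ) (hl : l ≠ μ) (hνl : ν ≠ l) :
    fill N A x μ = coons N A x μ ν l := by
  rcases transverse_cases hν hl hνl with ⟨h1, h2⟩ | ⟨h1, h2⟩
  · rw [fill, h1, h2]
  · rw [fill, h1, h2, coons_swap N A x μ hνl.symm]

/-! ## §3 Exactness on the boundary, submodule values, the sup bound -/

/-- The blend reproduces the data on the face `{x_ν = 0}`. [folklore] -/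
theorem coons_eq_of_fst_zero {N : ℕ} (hN : N ≠ 0) (A : (Fin 3 → ℤ) → Fin 3 → V) (x : Fin 3 → ℤ) (μ : Fin 3) {ν l : Fin 3} (hx : x ν = 0) :
    coons N A x μ ν l = A x μ := by
  have e1 : setc x ν 0 = x := by rw [← hx, setc_self]
  unfold coons
  rw [hx, w0_zero hN, w1_zero, e1]
  module

/-- The blend reproduces the data on the face `{x_ν = N}`. [folklore] -/
theorem coons_eq_of_fst_top {N : ℕ} (hN : N ≠ 0) (A : (Fin 3 → ℤ) → Fin 3 → V) (x : Fin 3 → ℤ) (μ : Fin 3) {ν l : Fin 3} (hx : x ν = N) :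
    coons N A x μ ν l = A x μ := by
  have e1 : setc x ν N = x := by rw [← hx, setc_self]
  unfold coons
  rw [hx, w0_top, w1_top hN, e1]
  module

/-- **★ EXACTNESS ON THE BOUNDARY**: on every bond lying in a face of the cube the fill IS the datum. [folklore] -/
theorem fill_eq_of_bdry {N : ℕ} (hN : N ≠ 0) (A : (Fin 3 → ℤ) → Fin 3 → V) {x : Fin 3 → ℤ} {μ : Fin 3} (h : BdryBond N x μ) : fill N A x μ = A x μ := by
  obtain ⟨i, hi, hx⟩ := h
  -- write the fill with `i` as the FIRST transverse direction
  obtain ⟨j, hj, hij⟩ : ∃ j, j ≠ μ ∧ i ≠ j := by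
    rcases eq_tA_or_tB hi with rfl | rfl
    · exact ⟨tB μ, tB_ne μ, tA_ne_tB μ⟩
    · exact ⟨tA μ, tA_ne μ, (tA_ne_tB μ).symm⟩
  rw [fill_eq_coons N A x hi hj hij]
  rcases hx with hx | hx
  · exact coons_eq_of_fst_zero hN A x μ hx
  · exact coons_eq_of_fst_top hN A x μ hx

/-- **VALUES IN A SUBMODULE**: if the data take values in an `ℝ`-submodule `S` (e.g. `𝔰𝔲(n) ⊂ M_n(ℂ)`), so does the fill. [folklore] -/
theorem fill_mem (N : ℕ) (S : Submodule ℝ V) {A : (Fin 3 → ℤ) → Fin 3 → V} (hA : ∀ y μ, A y μ ∈ S) (x : Fin 3 → ℤ) (μ : Fin 3) : fill N A x μ ∈ S := by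
  unfold fill coons
  refine S.sub_mem (S.add_mem (S.add_mem (S.add_mem (S.smul_mem _ (hA _ _)) (S.smul_mem _ (hA _ _))) (S.smul_mem _ (hA _ _))) (S.smul_mem _ (hA _ _))) ?_
  exact S.add_mem (S.smul_mem _ (S.add_mem (S.smul_mem _ (hA _ _)) (S.smul_mem _ (hA _ _)))) (S.smul_mem _ (S.add_mem (S.smul_mem _ (hA _ _)) (S.smul_mem _ (hA _ _))))

end TransfiniteFill

namespace TransfiniteFill

variable {V : Type*} [NormedAddCommGroup V] [NormedSpace ℝ V]

/-- **★ THE SUP BOUND**: in the cube, `‖fill N A x μ‖ ≤ 3·a` whenever `‖A‖ ≤ a` on the boundary bonds (the four face weights sum to `2`, the four corner weights to `1`). [folklore] -/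
theorem norm_fill_le {N : ℕ} (hN : N ≠ 0) (A : (Fin 3 → ℤ) → Fin 3 → V) {a : ℝ} (hA : ∀ y μ, InBox N y → BdryBond N y μ → ‖A y μ‖ ≤ a)
    {x : Fin 3 → ℤ} (hx : InBox N x) (μ : Fin 3) : ‖fill N A x μ‖ ≤ 3 * a := by
  have hN0 : (0 : ℤ) ≤ N := by exact_mod_cast Nat.zero_le N
  set ν := tA μ
  set l := tB μ
  have hν : ν ≠ μ := tA_ne μ
  have hl : l ≠ μ := tB_ne μ
  have hνl : ν ≠ l := tA_ne_tB μ
  -- weights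
  have a0 : 0 ≤ w0 N (x ν) := w0_nonneg (hx ν).2
  have a1 : 0 ≤ w1 N (x ν) := w1_nonneg N (hx ν).1
  have b0 : 0 ≤ w0 N (x l) := w0_nonneg (hx l).2
  have b1 : 0 ≤ w1 N (x l) := w1_nonneg N (hx l).1
  have sa : w0 N (x ν) + w1 N (x ν) = 1 := w0_add_w1 hN _
  have sb : w0 N (x l) + w1 N (x l) = 1 := w0_add_w1 hN _
  -- the eight data are on boundary bonds of the cube
  have hb : ∀ (i : Fin 3), i ≠ μ → ∀ v : ℤ, (v = 0 ∨ v = N) → ‖A (setc x i v) μ‖ ≤ a := fun i hi v hv => by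
    rcases hv with rfl | rfl
    · exact hA _ _ (inBox_setc hx i le_rfl hN0) (bdry_setc_zero N x hi)
    · exact hA _ _ (inBox_setc hx i hN0 le_rfl) (bdry_setc_top N x hi)
  have hc : ∀ v w : ℤ, (v = 0 ∨ v = N) → (w = 0 ∨ w = N) → ‖A (setc (setc x ν v) l w) μ‖ ≤ a := fun v w hv hw => by
    have hvb : InBox N (setc x ν v) := by rcases hv with rfl | rfl <;> [exact inBox_setc hx ν le_rfl hN0; exact inBox_setc hx ν hN0 le_rfl]
    have hwb : InBox N (setc (setc x ν v) l w) := by rcases hw with rfl | rfl <;> [exact inBox_setc hvb l le_rfl hN0; exact inBox_setc hvb l hN0 le_rfl]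
    exact hA _ _ hwb (bdry_setc_setc_inner N x hν hνl hv w)
  have ha0 : 0 ≤ a := (norm_nonneg _).trans (hb ν hν 0 (Or.inl rfl))
  unfold fill coons
  calc _ ≤ ‖w0 N (x ν) • A (setc x ν 0) μ + w1 N (x ν) • A (setc x ν ↑N) μ + w0 N (x l) • A (setc x l 0) μ + w1 N (x l) • A (setc x l ↑N) μ‖ +
        ‖w0 N (x ν) • (w0 N (x l) • A (setc (setc x ν 0) l 0) μ + w1 N (x l) • A (setc (setc x ν 0) l ↑N) μ) +
          w1 N (x ν) • (w0 N (x l) • A (setc (setc x ν ↑N) l 0) μ + w1 N (x l) • A (setc (setc x ν ↑N) l ↑N) μ)‖ := norm_sub_le _ _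
    _ ≤ (w0 N (x ν) * a + w1 N (x ν) * a + w0 N (x l) * a + w1 N (x l) * a) +
        (w0 N (x ν) * (w0 N (x l) * a + w1 N (x l) * a) + w1 N (x ν) * (w0 N (x l) * a + w1 N (x l) * a)) := by
        gcongr
        · refine (norm_add_le _ _).trans (add_le_add ((norm_add_le _ _).trans (add_le_add ((norm_add_le _ _).trans (add_le_add ?_ ?_)) ?_)) ?_)
          · rw [norm_smul, Real.norm_of_nonneg a0]; exact mul_le_mul_of_nonneg_left (hb ν hν 0 (Or.inl rfl)) a0
          · rw [norm_smul, Real.norm_of_nonneg a1]; exact mul_le_mul_of_nonneg_left (hb ν hν N (Or.inr rfl)) a1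
          · rw [norm_smul, Real.norm_of_nonneg b0]; exact mul_le_mul_of_nonneg_left (hb l hl 0 (Or.inl rfl)) b0
          · rw [norm_smul, Real.norm_of_nonneg b1]; exact mul_le_mul_of_nonneg_left (hb l hl N (Or.inr rfl)) b1
        · refine (norm_add_le _ _).trans (add_le_add ?_ ?_)
          · rw [norm_smul, Real.norm_of_nonneg a0]
            refine mul_le_mul_of_nonneg_left ((norm_add_le _ _).trans (add_le_add ?_ ?_)) a0
            · rw [norm_smul, Real.norm_of_nonneg b0]; exact mul_le_mul_of_nonneg_left (hc 0 0 (Or.inl rfl) (Or.inl rfl)) b0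
            · rw [norm_smul, Real.norm_of_nonneg b1]; exact mul_le_mul_of_nonneg_left (hc 0 N (Or.inl rfl) (Or.inr rfl)) b1
          · rw [norm_smul, Real.norm_of_nonneg a1]
            refine mul_le_mul_of_nonneg_left ((norm_add_le _ _).trans (add_le_add ?_ ?_)) a1
            · rw [norm_smul, Real.norm_of_nonneg b0]; exact mul_le_mul_of_nonneg_left (hc N 0 (Or.inr rfl) (Or.inl rfl)) b0
            · rw [norm_smul, Real.norm_of_nonneg b1]; exact mul_le_mul_of_nonneg_left (hc N N (Or.inr rfl) (Or.inr rfl)) b1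
    _ = 3 * a := by
        have e1 : w0 N (x ν) * a + w1 N (x ν) * a = a := by rw [← add_mul, sa, one_mul]
        have e2 : w0 N (x l) * a + w1 N (x l) * a = a := by rw [← add_mul, sb, one_mul]
        rw [e2, ← add_mul (w0 N (x ν)) (w1 N (x ν)) a, sa, one_mul]
        linarith [e1, e2]

/-! ## §4 The curl of the fill -/

/-- **THE LATTICE CURL ON `ℤ³`**: `B(x,μ) + B(x+e_μ,ν) − B(x+e_ν,μ) − B(x,ν)`. [folklore] -/
def dcurl (B : (Fin 3 → ℤ) → Fin 3 → V) (x : Fin 3 → ℤ) (μ ν : Fin 3) : V := B x μ + B (bump x μ) ν - B (bump x ν) μ - B x ν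

/-- **THE REMAINDER OF THE CURL IDENTITY**: `(1∕N)` times eight boundary values with weights of modulus `≤ 1`. [folklore] -/
def rem (N : ℕ) (A : (Fin 3 → ℤ) → Fin 3 → V) (x : Fin 3 → ℤ) (μ ν l : Fin 3) : V :=
  (N : ℝ)⁻¹ • (A (setc x ν 0) μ - A (setc x ν N) μ - A (setc x μ 0) ν + A (setc x μ N) ν)
    - (N : ℝ)⁻¹ • (w0 N (x l) • (A (setc (setc x ν 0) l 0) μ - A (setc (setc x ν N) l 0) μ) + w1 N (x l) • (A (setc (setc x ν 0) l N) μ - A (setc (setc x ν N) l N) μ))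
    + (N : ℝ)⁻¹ • (w0 N (x l) • (A (setc (setc x μ 0) l 0) ν - A (setc (setc x μ N) l 0) ν) + w1 N (x l) • (A (setc (setc x μ 0) l N) ν - A (setc (setc x μ N) l N) ν))

/-- **★★ THE CURL IDENTITY OF THE COONS FILL**: at every plaquette `(x; μ, ν)` with third direction `l`,
`dcurl (fill N A) x μ ν = w0(x_l) • dcurl A (x|l↦0) μ ν + w1(x_l) • dcurl A (x|l↦N) μ ν + rem` — the blend uses the SAME `l`-weights for the `μ`- and the `ν`-component, so the two
face CURLS (on `{x_l = 0}` and `{x_l = N}`) appear, and everything else is `(1∕N)`× boundary values. [folklore] -/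
theorem dcurl_fill_eq {N : ℕ} (hN : N ≠ 0) (A : (Fin 3 → ℤ) → Fin 3 → V) (x : Fin 3 → ℤ) {μ ν l : Fin 3} (hμν : μ ≠ ν) (hμl : μ ≠ l) (hνl : ν ≠ l) :
    dcurl (fill N A) x μ ν = w0 N (x l) • dcurl A (setc x l 0) μ ν + w1 N (x l) • dcurl A (setc x l N) μ ν + rem N A x μ ν l := by
  unfold dcurl
  rw [fill_eq_coons N A x hμν.symm hμl.symm hνl, fill_eq_coons N A (bump x ν) hμν.symm hμl.symm hνl,
    fill_eq_coons N A (bump x μ) hμν hνl.symm hμl, fill_eq_coons N A x hμν hνl.symm hμl]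
  unfold coons rem
  simp only [bump_apply_same, bump_apply_ne _ hνl.symm, bump_apply_ne _ hμl.symm, setc_bump_same, setc_bump_ne _ hνl.symm, setc_bump_ne _ hμl.symm,
    w0_succ hN, w1_succ hN]
  module

/-- **★★ THE CURL BOUND OF THE COONS FILL**: at every plaquette of the cube (`x`, `x + e_μ`, `x + e_ν` in the box), `‖dcurl (fill N A) x μ ν‖ ≤ b + 8·a∕N` from `‖dcurl A‖ ≤ b` at the
plaquettes of the two faces `{x_l = 0}`, `{x_l = N}` (where all four bonds are boundary data) and `‖A‖ ≤ a` on the boundary bonds. [folklore] -/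
theorem norm_dcurl_fill_le {N : ℕ} (hN : N ≠ 0) (A : (Fin 3 → ℤ) → Fin 3 → V) {a b : ℝ} (hA : ∀ y μ, InBox N y → BdryBond N y μ → ‖A y μ‖ ≤ a)
    {x : Fin 3 → ℤ} {μ ν l : Fin 3} (hμν : μ ≠ ν) (hμl : μ ≠ l) (hνl : ν ≠ l) (hx : InBox N x)
    (hb0 : ‖dcurl A (setc x l 0) μ ν‖ ≤ b) (hbN : ‖dcurl A (setc x l N) μ ν‖ ≤ b) :
    ‖dcurl (fill N A) x μ ν‖ ≤ b + 8 * a / N := by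
  have hN0 : (0 : ℤ) ≤ N := by exact_mod_cast Nat.zero_le N
  have hNr : (0 : ℝ) < N := by exact_mod_cast Nat.pos_of_ne_zero hN
  have c0 : 0 ≤ w0 N (x l) := w0_nonneg (hx l).2
  have c1 : 0 ≤ w1 N (x l) := w1_nonneg N (hx l).1
  have sc : w0 N (x l) + w1 N (x l) = 1 := w0_add_w1 hN _
  -- the eight boundary values in `rem`
  have hb : ∀ (i j : Fin 3), i ≠ j → ∀ v : ℤ, (v = 0 ∨ v = N) → ‖A (setc x i v) j‖ ≤ a := fun i j hij v hv => by
    rcases hv with rfl | rfl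
    · exact hA _ _ (inBox_setc hx i le_rfl hN0) (bdry_setc_zero N x hij)
    · exact hA _ _ (inBox_setc hx i hN0 le_rfl) (bdry_setc_top N x hij)
  have hc : ∀ (i j : Fin 3), i ≠ j → i ≠ l → ∀ v w : ℤ, (v = 0 ∨ v = N) → (w = 0 ∨ w = N) → ‖A (setc (setc x i v) l w) j‖ ≤ a :=
    fun i j hij hil v w hv hw => by
    have hvb : InBox N (setc x i v) := by rcases hv with rfl | rfl <;> [exact inBox_setc hx i le_rfl hN0; exact inBox_setc hx i hN0 le_rfl]
    have hwb : InBox N (setc (setc x i v) l w) := by rcases hw with rfl | rfl <;> [exact inBox_setc hvb l le_rfl hN0; exact inBox_setc hvb l hN0 le_rfl]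
    exact hA _ _ hwb (bdry_setc_setc_inner N x hij hil hv w)
  have ha0 : 0 ≤ a := (norm_nonneg _).trans (hb ν μ hμν.symm 0 (Or.inl rfl))
  -- the remainder
  have hrem : ‖rem N A x μ ν l‖ ≤ 8 * a / N := by
    unfold rem
    have hinv : ‖(N : ℝ)⁻¹‖ = (N : ℝ)⁻¹ := Real.norm_of_nonneg (inv_nonneg.mpr hNr.le)
    have g1 : ‖A (setc x ν 0) μ - A (setc x ν ↑N) μ - A (setc x μ 0) ν + A (setc x μ ↑N) ν‖ ≤ a + a + a + a :=
      (norm_add_le _ _).trans (add_le_add ((norm_sub_le _ _).trans (add_le_add ((norm_sub_le _ _).trans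
        (add_le_add (hb ν μ hμν.symm 0 (Or.inl rfl)) (hb ν μ hμν.symm N (Or.inr rfl)))) (hb μ ν hμν 0 (Or.inl rfl)))) (hb μ ν hμν N (Or.inr rfl)))
    have g2 : ‖w0 N (x l) • (A (setc (setc x ν 0) l 0) μ - A (setc (setc x ν ↑N) l 0) μ) + w1 N (x l) • (A (setc (setc x ν 0) l ↑N) μ - A (setc (setc x ν ↑N) l ↑N) μ)‖
        ≤ w0 N (x l) * (a + a) + w1 N (x l) * (a + a) := by
      refine (norm_add_le _ _).trans (add_le_add ?_ ?_)
      · rw [norm_smul, Real.norm_of_nonneg c0]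
        exact mul_le_mul_of_nonneg_left ((norm_sub_le _ _).trans (add_le_add (hc ν μ hμν.symm hνl 0 0 (Or.inl rfl) (Or.inl rfl)) (hc ν μ hμν.symm hνl N 0 (Or.inr rfl) (Or.inl rfl)))) c0
      · rw [norm_smul, Real.norm_of_nonneg c1]
        exact mul_le_mul_of_nonneg_left ((norm_sub_le _ _).trans (add_le_add (hc ν μ hμν.symm hνl 0 N (Or.inl rfl) (Or.inr rfl)) (hc ν μ hμν.symm hνl N N (Or.inr rfl) (Or.inr rfl)))) c1
    have g3 : ‖w0 N (x l) • (A (setc (setc x μ 0) l 0) ν - A (setc (setc x μ ↑N) l 0) ν) + w1 N (x l) • (A (setc (setc x μ 0) l ↑N) ν - A (setc (setc x μ ↑N) l ↑N) ν)‖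
        ≤ w0 N (x l) * (a + a) + w1 N (x l) * (a + a) := by
      refine (norm_add_le _ _).trans (add_le_add ?_ ?_)
      · rw [norm_smul, Real.norm_of_nonneg c0]
        exact mul_le_mul_of_nonneg_left ((norm_sub_le _ _).trans (add_le_add (hc μ ν hμν hμl 0 0 (Or.inl rfl) (Or.inl rfl)) (hc μ ν hμν hμl N 0 (Or.inr rfl) (Or.inl rfl)))) c0
      · rw [norm_smul, Real.norm_of_nonneg c1]
        exact mul_le_mul_of_nonneg_left ((norm_sub_le _ _).trans (add_le_add (hc μ ν hμν hμl 0 N (Or.inl rfl) (Or.inr rfl)) (hc μ ν hμν hμl N N (Or.inr rfl) (Or.inr rfl)))) c1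
    have hw2 : w0 N (x l) * (a + a) + w1 N (x l) * (a + a) = 2 * a := by rw [← add_mul, sc]; ring
    calc _ ≤ ‖(N : ℝ)⁻¹ • (A (setc x ν 0) μ - A (setc x ν ↑N) μ - A (setc x μ 0) ν + A (setc x μ ↑N) ν)‖ +
          ‖(N : ℝ)⁻¹ • (w0 N (x l) • (A (setc (setc x ν 0) l 0) μ - A (setc (setc x ν ↑N) l 0) μ) + w1 N (x l) • (A (setc (setc x ν 0) l ↑N) μ - A (setc (setc x ν ↑N) l ↑N) μ))‖ +
          ‖(N : ℝ)⁻¹ • (w0 N (x l) • (A (setc (setc x μ 0) l 0) ν - A (setc (setc x μ ↑N) l 0) ν) + w1 N (x l) • (A (setc (setc x μ 0) l ↑N) ν - A (setc (setc x μ ↑N) l ↑N) ν))‖ :=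
          (norm_add_le _ _).trans (add_le_add (norm_sub_le _ _) le_rfl)
      _ ≤ (N : ℝ)⁻¹ * (a + a + a + a) + (N : ℝ)⁻¹ * (2 * a) + (N : ℝ)⁻¹ * (2 * a) := by
          rw [norm_smul, norm_smul, norm_smul, hinv, ← hw2]
          gcongr
      _ = 8 * a / N := by field_simp; ring
  rw [dcurl_fill_eq hN A x hμν hμl hνl]
  calc _ ≤ ‖w0 N (x l) • dcurl A (setc x l 0) μ ν‖ + ‖w1 N (x l) • dcurl A (setc x l ↑N) μ ν‖ + ‖rem N A x μ ν l‖ := norm_add₃_le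
    _ ≤ w0 N (x l) * b + w1 N (x l) * b + 8 * a / N := by
        rw [norm_smul, norm_smul, Real.norm_of_nonneg c0, Real.norm_of_nonneg c1]
        exact add_le_add (add_le_add (mul_le_mul_of_nonneg_left hb0 c0) (mul_le_mul_of_nonneg_left hbN c1)) hrem
    _ = b + 8 * a / N := by rw [← add_mul, sc, one_mul]

end TransfiniteFill

end Summit.QuantumFields.YangMills.Theorems

end
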